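import Mathlib
import HarnessLib
import Summits.NavierStokesRegularity.NavierStokesRegularity.Theorems.ChiralWindowDoorDefs
import Summits.NavierStokesRegularity.NavierStokesRegularity.Theorems.ChiralWindowDoorFracLapHalfBounds
import Summits.NavierStokesRegularity.NavierStokesRegularity.Theorems.ChiralWindowDoorLocalHelicityLower

/-!
# Door S20 «ChiralWindowDoor» — the TIME-INTEGRATED B2′ error is bounded uniformly in `R`:
# `∫_{−∞}^{0} R² ∫ (R‖y‖+√(−t))⁻⁴ |Λ a₁(y)| dy dt ≤ ∫ ‖y‖⁻² |Λ a₁(y)| dy = c₁(η)`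

Door S20 of nsreg-p1's local Type-I door family (`HOME/ns-regularity-ideate-p1/r19/R19-LINE.md` §B2′; DESIGN-ONLY,
route NOT born).  `…LocalDissipationPointwise.localDissipation_pointwise` bounds the B2′ defect at time `t` by
`c · E_R(t)`, `E_R(t) = R² ∫ ((R‖y‖+√(−t))⁴)⁻¹ |Λ a₁(y)| dy`.  Here the time integral of `E_R` over `(−∞,0)` is
computed/bounded uniformly in `R`: for `b > 0`, `(b + √s)⁴ ≥ (b² + s)²`, so
`∫_{−∞}^{0} R²((b+√(−t))⁴)⁻¹ dt ≤ ∫_0^∞ R²(b²+s)⁻² ds = R²/b²`, which is `‖y‖⁻²` at `b = R‖y‖`; Tonelli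
(`integrable_prod_iff'`, `integral_integral_swap`) then gives

  `∫_{t<0} E_R(t) dt ≤ ∫ ‖y‖⁻² |Λ a₁(y)| dy = c₁(η)`   (the constant of B1′, `…LocalHelicityLower`),

together with the integrability of `E_R` on `(−∞,0)`.

* `integral_Ioi_inv_sq_add` — `∫_0^∞ R²((b²+s)²)⁻¹ ds = R²/b²` and integrability;
* `integrableOn_Iio_comp_neg` — transport `Ioi ↔ Iio` under `t ↦ −t`;
* `integral_Iio_kernel_le` — `∫_{t<0} R²((b+√(−t))⁴)⁻¹ dt ≤ R²/b²`;
* `continuous_fracLapHalfS_bumpSq_one` — `Λ a₁` is continuous;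
* `timeIntegratedError_le` — **the `R`-uniform bound** (and integrability of `E_R` on `(−∞,0)`).

Seat nsreg-p6 g11 (THEOREMS-ONLY door sequels, DIRECTOR-NS g8 #32 (2)/#36).  WHAT THIS IS NOT: not NS regularity
(Clay A); not yet B2′ (the `t`-measurability/integrability of the Gagliardo and helicity-dissipation functionals of the
vorticity slices remains); no route is opened.
-/

noncomputable section

-- the summit and its single sub-problem share the name (CONVENTIONS §1), as in every Theorems file
set_option linter.dupNamespace false

namespace Summit.NavierStokesRegularity.NavierStokesRegularity.Theorems.ChiralWindowDoorTimeIntegratedError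

open MeasureTheory Set Filter Topology Metric Function
open scoped RealInnerProductSpace
open Summit.NavierStokesRegularity.NavierStokesRegularity.Theorems.ChiralWindowDoorDefs
open Summit.NavierStokesRegularity.NavierStokesRegularity.Theorems.ChiralWindowDoorFracLapHalfBounds
open Summit.NavierStokesRegularity.NavierStokesRegularity.Theorems.ChiralWindowDoorLocalHelicityLower

/-! ### The one-dimensional time integral -/

/-- `∫_0^∞ R² ((b² + s)²)⁻¹ ds = R²/b²` (`b > 0`), with integrability (primitive `−R²(b²+s)⁻¹`). -/
theorem integral_Ioi_inv_sq_add {b : ℝ} (hb : 0 < b) (R : ℝ) :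
    IntegrableOn (fun s : ℝ => R ^ 2 * ((b ^ 2 + s) ^ 2)⁻¹) (Ioi 0) ∧
      ∫ s in Ioi (0 : ℝ), R ^ 2 * ((b ^ 2 + s) ^ 2)⁻¹ = R ^ 2 / b ^ 2 := by
  set G : ℝ → ℝ := fun s => -(R ^ 2) / (b ^ 2 + s) with hG
  have hderiv : ∀ s ∈ Ioi (0 : ℝ), HasDerivAt G (R ^ 2 * ((b ^ 2 + s) ^ 2)⁻¹) s := by
    intro s hs
    have hpos : b ^ 2 + s ≠ 0 := by have : (0 : ℝ) < s := hs; positivity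
    have h1 : HasDerivAt (fun s : ℝ => b ^ 2 + s) 1 s := by
      simpa using (hasDerivAt_id s).const_add (b ^ 2)
    have h2 := (hasDerivAt_const s (-(R ^ 2))).div h1 hpos
    refine h2.congr_deriv ?_
    field_simp
    ring
  have hcont : ContinuousWithinAt G (Ici 0) 0 := by
    have hne : b ^ 2 + (0 : ℝ) ≠ 0 := by positivity
    have hc : ContinuousAt G 0 := continuousAt_const.div (continuousAt_const.add continuousAt_id) hne
    exact hc.continuousWithinAt
  have hnonneg : ∀ s ∈ Ioi (0 : ℝ), 0 ≤ R ^ 2 * ((b ^ 2 + s) ^ 2)⁻¹ := fun s _ => by positivity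
  have hlim : Tendsto G atTop (𝓝 0) := by
    have h1 : Tendsto (fun s : ℝ => b ^ 2 + s) atTop atTop := tendsto_atTop_add_const_left _ _ tendsto_id
    exact tendsto_const_nhds.div_atTop h1
  refine ⟨integrableOn_Ioi_deriv_of_nonneg hcont hderiv hnonneg hlim, ?_⟩
  rw [integral_Ioi_of_hasDerivAt_of_nonneg hcont hderiv hnonneg hlim, hG]
  simp only [add_zero]
  ring

/-- Transport of integrability under `t ↦ −t`: `IntegrableOn f (Ioi (−c)) → IntegrableOn (f ∘ neg) (Iio c)`. -/
theorem integrableOn_Iio_comp_neg {f : ℝ → ℝ} {c : ℝ} (hf : IntegrableOn f (Ioi (-c))) :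
    IntegrableOn (fun t => f (-t)) (Iio c) := by
  have A : MeasurableEmbedding fun x : ℝ => -x := (Homeomorph.neg ℝ).isClosedEmbedding.measurableEmbedding
  have h := (A.integrableOn_map_iff (μ := volume) (f := f) (s := Ioi (-c))).1
    (by rw [Measure.map_neg_eq_self (volume : Measure ℝ)]; exact hf)
  have hpre : (fun x : ℝ => -x) ⁻¹' Ioi (-c) = Iio c := by
    ext t; simp
  rw [hpre] at h
  exact h

/-- **`∫_{t<0} R²((b+√(−t))⁴)⁻¹ dt ≤ R²/b²`** for `b > 0` (majorant `R²((b²−t)²)⁻¹`, since `(b+√s)⁴ ≥ (b²+s)²`), with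
the integrability of the integrand on `(−∞,0)`. -/
theorem integral_Iio_kernel_le {b : ℝ} (hb : 0 < b) (R : ℝ) :
    IntegrableOn (fun t : ℝ => R ^ 2 * ((b + Real.sqrt (-t)) ^ 4)⁻¹) (Iio 0) ∧
      ∫ t in Iio (0 : ℝ), R ^ 2 * ((b + Real.sqrt (-t)) ^ 4)⁻¹ ≤ R ^ 2 / b ^ 2 := by
  obtain ⟨hgi, hgval⟩ := integral_Ioi_inv_sq_add hb R
  -- the majorant on `(−∞,0)`
  have hgi' : IntegrableOn (fun t : ℝ => R ^ 2 * ((b ^ 2 + -t) ^ 2)⁻¹) (Iio 0) :=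
    integrableOn_Iio_comp_neg (c := 0) (f := fun s => R ^ 2 * ((b ^ 2 + s) ^ 2)⁻¹) (by simpa using hgi)
  have hle : ∀ t : ℝ, t < 0 → R ^ 2 * ((b + Real.sqrt (-t)) ^ 4)⁻¹ ≤ R ^ 2 * ((b ^ 2 + -t) ^ 2)⁻¹ := by
    intro t ht
    have hnt : 0 < -t := neg_pos.2 ht
    refine mul_le_mul_of_nonneg_left (inv_anti₀ (by positivity) ?_) (sq_nonneg R)
    have hs : Real.sqrt (-t) ^ 2 = -t := Real.sq_sqrt hnt.le
    have hkey : b ^ 2 + -t ≤ (b + Real.sqrt (-t)) ^ 2 := by nlinarith [Real.sqrt_nonneg (-t), hb.le]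
    calc (b ^ 2 + -t) ^ 2 ≤ ((b + Real.sqrt (-t)) ^ 2) ^ 2 := pow_le_pow_left₀ (by nlinarith) hkey 2
      _ = (b + Real.sqrt (-t)) ^ 4 := by ring
  have hmeas : AEStronglyMeasurable (fun t : ℝ => R ^ 2 * ((b + Real.sqrt (-t)) ^ 4)⁻¹) (volume.restrict (Iio 0)) := by
    have hm : Measurable fun t : ℝ => R ^ 2 * ((b + Real.sqrt (-t)) ^ 4)⁻¹ :=
      measurable_const.mul ((measurable_const.add (Real.continuous_sqrt.measurable.comp measurable_neg)).pow_const _).inv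
    exact hm.aestronglyMeasurable
  have hfi : IntegrableOn (fun t : ℝ => R ^ 2 * ((b + Real.sqrt (-t)) ^ 4)⁻¹) (Iio 0) := by
    refine hgi'.mono' hmeas ((ae_restrict_iff' measurableSet_Iio).2 (ae_of_all _ fun t ht => ?_))
    rw [Real.norm_eq_abs, abs_of_nonneg (by positivity)]
    exact hle t ht
  refine ⟨hfi, ?_⟩
  calc ∫ t in Iio (0 : ℝ), R ^ 2 * ((b + Real.sqrt (-t)) ^ 4)⁻¹
      ≤ ∫ t in Iio (0 : ℝ), R ^ 2 * ((b ^ 2 + -t) ^ 2)⁻¹ :=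
        setIntegral_mono_on hfi hgi' measurableSet_Iio fun t ht => hle t ht
    _ = ∫ t in Iic (0 : ℝ), R ^ 2 * ((b ^ 2 + -t) ^ 2)⁻¹ := integral_Iic_eq_integral_Iio.symm
    _ = ∫ s in Ioi (-(0 : ℝ)), R ^ 2 * ((b ^ 2 + s) ^ 2)⁻¹ :=
        integral_comp_neg_Iic 0 (fun s => R ^ 2 * ((b ^ 2 + s) ^ 2)⁻¹)
    _ = R ^ 2 / b ^ 2 := by rw [neg_zero, hgval]

/-! ### Tonelli -/

variable {η : EuclideanSpace ℝ (Fin 3) → ℝ}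

/-- `Λ a₁` is continuous (`a₁ = bumpSq η 1`). -/
theorem continuous_fracLapHalfS_bumpSq_one (hη : IsAdmissibleBump η) : Continuous (fracLapHalfS (bumpSq η 1)) := by
  obtain ⟨A₂, hA₂⟩ := exists_secondDiff_bound_bumpSq hη one_pos
  have ha0 : ∀ x, |bumpSq η 1 x| ≤ 1 := fun x => by
    rw [abs_of_nonneg (bumpSq_nonneg η 1 x)]; exact bumpSq_le_one hη 1 x
  have h := continuous_secondDiffOp_real (continuous_bumpSq hη 1) ha0 hA₂ 0
  rw [lamKTrunc_zero] at h
  exact continuous_const.mul h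

/-- **The time-integrated B2′ error is bounded uniformly in `R`**: for `R > 0`,
`t ↦ E_R(t) = R² ∫ ((R‖y‖+√(−t))⁴)⁻¹ |Λ a₁(y)| dy` is integrable on `(−∞,0)` and
`∫_{t<0} E_R(t) dt ≤ ∫ ‖y‖⁻² |Λ a₁(y)| dy = c₁(η)`. -/
theorem timeIntegratedError_le (hη : IsAdmissibleBump η) {R : ℝ} (hR : 0 < R) :
    IntegrableOn (fun t : ℝ => R ^ 2 * ∫ y : EuclideanSpace ℝ (Fin 3),
        ((R * ‖y‖ + Real.sqrt (-t)) ^ 4)⁻¹ * |fracLapHalfS (bumpSq η 1) y|) (Iio 0) ∧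
      ∫ t in Iio (0 : ℝ), R ^ 2 * ∫ y : EuclideanSpace ℝ (Fin 3),
          ((R * ‖y‖ + Real.sqrt (-t)) ^ 4)⁻¹ * |fracLapHalfS (bumpSq η 1) y| ≤
        ∫ y : EuclideanSpace ℝ (Fin 3), ‖y‖ ^ (-(2 : ℝ)) * |fracLapHalfS (bumpSq η 1) y| := by
  set μ : Measure ℝ := volume.restrict (Iio 0) with hμ
  set Φ : EuclideanSpace ℝ (Fin 3) → ℝ := fun y => |fracLapHalfS (bumpSq η 1) y| with hΦ
  set H : ℝ × EuclideanSpace ℝ (Fin 3) → ℝ := fun q =>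
    R ^ 2 * ((R * ‖q.2‖ + Real.sqrt (-q.1)) ^ 4)⁻¹ * Φ q.2 with hH
  have hΦc : Continuous Φ := (continuous_fracLapHalfS_bumpSq_one hη).abs
  have hΦnn : ∀ y, 0 ≤ Φ y := fun y => abs_nonneg _
  have hHnn : ∀ q, 0 ≤ H q := fun q => by rw [hH]; dsimp only; exact mul_nonneg (by positivity) (hΦnn _)
  -- measurability
  have hHm : Measurable H := by
    rw [hH]
    refine Measurable.mul (measurable_const.mul ?_) (hΦc.measurable.comp measurable_snd)
    exact (((measurable_const.mul (measurable_snd.norm)).add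
      (Real.continuous_sqrt.measurable.comp (measurable_fst.neg))).pow_const _).inv
  have hHae : AEStronglyMeasurable H (μ.prod volume) := hHm.aestronglyMeasurable
  -- (i) for `y ≠ 0`, the time integral
  have hy0 : ∀ᵐ y ∂(volume : Measure (EuclideanSpace ℝ (Fin 3))), y ≠ 0 := by rw [ae_iff]; simp
  have hslice : ∀ y : EuclideanSpace ℝ (Fin 3), y ≠ 0 →
      Integrable (fun t => H (t, y)) μ ∧ ∫ t, H (t, y) ∂μ ≤ ‖y‖ ^ (-(2 : ℝ)) * Φ y := by
    intro y hy
    have hypos : 0 < ‖y‖ := norm_pos_iff.2 hy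
    have hb : 0 < R * ‖y‖ := mul_pos hR hypos
    obtain ⟨hki, hkval⟩ := integral_Iio_kernel_le hb R
    refine ⟨?_, ?_⟩
    · have h := hki.mul_const (Φ y)
      rw [hH]; exact h
    · have hval : ∫ t, H (t, y) ∂μ = (∫ t in Iio (0 : ℝ), R ^ 2 * ((R * ‖y‖ + Real.sqrt (-t)) ^ 4)⁻¹) * Φ y := by
        rw [hH]; dsimp only
        rw [integral_mul_const]
      rw [hval]
      have hrpow : ‖y‖ ^ (-(2 : ℝ)) = R ^ 2 / (R * ‖y‖) ^ 2 := by
        rw [Real.rpow_neg hypos.le, show (2 : ℝ) = ((2 : ℕ) : ℝ) by norm_num, Real.rpow_natCast, mul_pow]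
        field_simp
      rw [hrpow]
      exact mul_le_mul_of_nonneg_right hkval (hΦnn y)
  -- (ii) integrability of `y ↦ ∫ ‖H(t,y)‖ dt`
  have hmaj : Integrable (fun y : EuclideanSpace ℝ (Fin 3) => ‖y‖ ^ (-(2 : ℝ)) * Φ y) :=
    integrable_rpow_mul_abs_fracLapHalfS_bumpSq_one hη
  have hnormint : Integrable (fun y : EuclideanSpace ℝ (Fin 3) => ∫ t, ‖H (t, y)‖ ∂μ) := by
    have hmeas' : AEStronglyMeasurable (fun y : EuclideanSpace ℝ (Fin 3) => ∫ t, ‖H (t, y)‖ ∂μ) volume :=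
      (hHae.prod_swap.norm).integral_prod_right'
    refine hmaj.mono' hmeas' ?_
    filter_upwards [hy0] with y hy
    obtain ⟨hiy, hley⟩ := hslice y hy
    have heq : ∫ t, ‖H (t, y)‖ ∂μ = ∫ t, H (t, y) ∂μ :=
      integral_congr_ae (ae_of_all _ fun t => by
        show ‖H (t, y)‖ = H (t, y)
        rw [Real.norm_eq_abs, abs_of_nonneg (hHnn _)])
    rw [Real.norm_eq_abs, abs_of_nonneg (integral_nonneg fun t => norm_nonneg _), heq]
    exact hley
  -- Tonelli: `H` integrable on the product
  have hHint : Integrable H (μ.prod volume) := by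
    refine (integrable_prod_iff' hHae).2 ⟨?_, hnormint⟩
    filter_upwards [hy0] with y hy using (hslice y hy).1
  -- the inner `y`-integral as a function of `t`
  have hinner : ∀ t : ℝ, R ^ 2 * ∫ y : EuclideanSpace ℝ (Fin 3),
      ((R * ‖y‖ + Real.sqrt (-t)) ^ 4)⁻¹ * |fracLapHalfS (bumpSq η 1) y| = ∫ y, H (t, y) := by
    intro t
    rw [hH]; dsimp only
    rw [← integral_const_mul]
    refine integral_congr_ae (ae_of_all _ fun y => ?_)
    ring
  refine ⟨?_, ?_⟩
  · have h := hHint.integral_prod_left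
    refine (h.congr (ae_of_all _ fun t => ?_))
    exact (hinner t).symm
  · have hunc : (uncurry fun (t : ℝ) (y : EuclideanSpace ℝ (Fin 3)) => H (t, y)) = H := funext fun p => rfl
    have hswap : ∫ t, ∫ y, H (t, y) ∂volume ∂μ = ∫ y, ∫ t, H (t, y) ∂μ ∂volume :=
      integral_integral_swap (by rw [hunc]; exact hHint)
    calc ∫ t in Iio (0 : ℝ), R ^ 2 * ∫ y : EuclideanSpace ℝ (Fin 3),
          ((R * ‖y‖ + Real.sqrt (-t)) ^ 4)⁻¹ * |fracLapHalfS (bumpSq η 1) y|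
        = ∫ t, ∫ y, H (t, y) ∂volume ∂μ := integral_congr_ae (ae_of_all _ fun t => hinner t)
      _ = ∫ y, ∫ t, H (t, y) ∂μ ∂volume := hswap
      _ ≤ ∫ y : EuclideanSpace ℝ (Fin 3), ‖y‖ ^ (-(2 : ℝ)) * Φ y := by
          refine integral_mono_of_nonneg (ae_of_all _ fun y => integral_nonneg fun t => hHnn _) hmaj ?_
          filter_upwards [hy0] with y hy using (hslice y hy).2

end Summit.NavierStokesRegularity.NavierStokesRegularity.Theorems.ChiralWindowDoorTimeIntegratedError
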